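import Summits.ABC.IUTFork.Joshi.FrobenioidsJoshiGlobal
import Summits.ABC.IUTFork.Joshi.ThetaJoshiConstruction
import HarnessLib

/-!
# Joshi, *Arithmetic Teichmüller spaces III* §10.11 «Mochizuki's Hodge Theaters via [Joshi, 2021a]»: the field of moduli
# `L_mod`, the descent `y ↦ y̲` = the standard arithmeticoid `arith(L_mod)_y` (Thm. 10.11.3.1), Hodge theaters à la Joshi
# (10.11.4.1) and Thm. 10.11.5.1 — TYPED, no side taken; with `Frob(arith(L)_y)` CONSTRUCTED from residue-field values

Record file of the abc-iut cell, branch E «type Joshi's construction, test vs S» (rung LADDER-ABC:A2.E; seat abc-iut-E-t32,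
slot T-34b = [J-III] §10.11 per plan/E/ASSIGNMENTS.md v2 and E-plan-2's §10 RULING 07:28:52Z; §1 below is seat
abc-iut-E-t34's OFFER draft `HOME/staging/E/t34/OFFER-E-t32-HodgeTheaters-sec10_11.lean` (sha16 38286282416b7d35) taken over with
thanks and re-based on seat E-t10's descent datum, §2 is this seat's concrete layer; inventory `HOME/plan/E/t32/INVENTORY.tsv`). Source: K. Joshi, *Construction of Arithmetic
Teichmüller Spaces III*, arXiv:2401.13508 **v4** ("Preliminary version for comments"), render `HOME/lit/renders/Joshi-arxiv-2401.13508/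
pNNNN.txt`, locator «p.N l.M» = line M of PDF page N; bib `Joshi2024ATS3`; [ATS II½] = arXiv:2305.10398 (`Joshi2023ATS2half`).
UNREFEREED preprint, rejected by the IUT author [Mochizuki2024JoshiReport], accepted by neither side of the Scholze–Stix / Mochizuki
dispute: everything below is TYPED AS A CANDIDATE (D-0012); typed ≠ proved ≠ endorsed; Joshi's assertions are named `def … : Prop` with
`@[claim "Joshi2024ATS3" "disputed"]`, never asserted; what FOLLOWS from the typed signature is a proved `theorem`. E-PLAN R14: no import
of the frozen Cor. 3.12 interface (our side is cited BY NAME in docstrings only).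

CARRIERS imported BY NAME (no restatement): `ATS3.ElementaryFrobenioid` / `.Iso` / `.IsIso` and `Frob.toModel` (seat E-t34,
`Joshi/FrobenioidsJoshiGlobal.lean` p431166: the elementary triple `(Φ, Φ^gp, B → Φ^gp)` of p.128 l.69–73), the local tempered-Frobenioid data as a TYPE PARAMETER `FT` (instantiate with seat E-t34's `ATS3.TemperedCoverings`,
`Joshi/TemperedFrobenioidsJoshi.lean`: Mochizuki's tempered Frobenioid `Frob^temp(X/E;K)` à la Joshi, §10.7–§10.9),
`ATS3.Frob.*` (this seat, `Joshi/FrobenioidsJoshi.lean` p430621: `O^▹`, `Φ(K) ≃ |O^▹_K|`, `x ↦ x mod O^*`, induced structures,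
`IsPerfectDiv`).
* §1 (§10.11.1–§10.11.5, p.138 l.51 – p.141 l.44) over the SIGNATURE `HodgeTheaterDatum M`, `M` = seat E-t10's `ATS3.ModuliDescentDatum` ([J-III] §6.1:
  places `V_{L′}`, `V_{L_mod}` with the choice
  «`V_{L_mod} ≃ V ⊂ V_{L′}`» of §3.1/§3.3, the factors `|𝒴_{ℂ_p^♭,L′_w}|` of `𝒴_{L′}` [ATS II½ Def. 4.1.1], the maps `f_{w|v}` of [FF18 Prop.
  2.3.20], holomorphoids with their points and local holomorphoids, `J̃(X/L) = ∏_v J(X,L_v)` [ATS I Thm. 9.3.1] with «points ↦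
  arithmeticoids» [ATS II½ Prop. 6.1.2], the tempered Frobenioid of a local holomorphoid [§10.9, ATS II½ Def. 5.14.1], and the Frobenioids
  `Frob(arith(L_mod)_y)`, `Frob(arith(L_mod)_y)^ℝ`, `Frob(L_mod)^pf`, `Frob(L_mod)^ℝ` as DATA): **Thm. 10.11.3.1** (1)–(2) = the printed
  CONSTRUCTION `y̲ := (f_{w|v}(y′_w))_{w ∈ V}` (p.140 l.1–25) = seat E-t10's `ModuliDescentDatum.descend` ([J-III] Thm. 6.1.1 is the same sentence) composed with points / adelic points as `moduliOfHol` / `moduliOfPoint` (the STANDARD ARITHMETICOID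
  `arith(L_mod)_y` used at p.100 l.17, p.106 l.28 and in the statement of Prop. 9.7.5.1, p.112 l.43); (3) = claim-Prop
  `ArithFrobenioidsOfModuli`; (10.11.4.1)–(10.11.4.2) `HT(hol(X/L′)_y) = ({Frob^temp((X/L′_v,X/K_v))}_v, Frob(arith(L_mod)_y)^ℝ)` «in the
  sense of [IUTchI, Definition 3.6]» = `HodgeTheater`, `hodgeTheaterOf` (labelled by `y`, Rmk. 10.11.4.3); **Thm. 10.11.5.1** «all these
  distinct holomorphoids give rise to isomorphic Hodge Theaters» = claim-Prop `HodgeTheatersIsomorphic` over `HodgeTheater.Iso`;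
  Rmk. 10.11.5.2 (1)–(5) = verbatim locator (interpretive; E6 attach point for Mochizuki2024JoshiReport; no `Prop`, no adjudication).
* §2 (this seat): the residue-field VALUES behind the data of §1 — `ArithmeticoidAbsDatum` (= the `AbsoluteValue`-valued twin of seat
  T-37's `ATS2h.DeformationDatum` residue-field data `K_{y_v}`, `|−|_{K_{y_v}}`, `L_v ↪ K_{y_v}`; merge-debt: a bridge where `|−|_{K_y}`
  is an absolute value), `Frob(arith(L)_y) = (L^*, ⊕_v O^▹_{K_v}/O^*_{K_v}, x ↦ (ι_v x mod O^*_{K_v})_v)` [ATS II½ Def. 5.14.2] CONSTRUCTED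
  as an `ElementaryFrobenioid` (`frobArith`; print «⊕», here `∏` — the finiteness of `{v : |x|_v ≠ 1}` is a property of the standard
  arithmeticoid, flagged), its realification `Frob(arith(L)_y)^ℝ` [ATS II½ §5.16] (`frobArithR`, value groups enlarged to `ℝ^×`), and
  Thm. 10.11.3.1 (3)'s «(perfect) frobenioid» DERIVED when the `K_{y_v}` are algebraically closed (`isPerfectDiv_frobArith`).
OUR SIDE BY NAME: `Literature.IUT.HodgeTheaters.ThetaHodgeTheater` ([IUTchI] Def. 3.6 `({†F̲_v}_{v∈V̲}, †F⊩_mod)`, every theater an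
isomorph of the reference data) and `ThetaHodgeTheater.Iso` (Rmk. 3.6.2) — same SHAPE as `HodgeTheater` / `HodgeTheater.Iso`; flags for
E-ref: Joshi indexes the local data by ALL `v ∈ V_{L′}` (10.11.4.2), [IUTchI] by `v̲ ∈ V̲ ≃ V_mod`; «isomorphic Hodge Theaters» is read as
isomorphisms of all constituents. Deliberately NOT here: any test against S. [claim: Joshi2024ATS3, status: disputed]
-/

noncomputable section

namespace Summit.ABC.IUTFork.Joshi.ATS3


/-! ## 1. §10.11.1–§10.11.5 over seat E-t10's descent datum (Thm. 10.11.3.1 = Thm. 6.1.1 restated) -/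

/-- **The data of §10.11.2–§10.11.4 over which Thm. 10.11.3.1 and the Hodge theater (10.11.4.1) are stated** (p.138 l.54 – p.140 l.37), layered
on seat E-t10's `ATS3.ModuliDescentDatum` (`Joshi/ThetaJoshiConstruction.lean`, [J-III] §6.1: the places `V_{L′}`, `V_{L_mod}`, «the bijection (see
§ 3.1, § 3.3) `V_{L_mod} ≃ V ⊂ V_{L′}`» as the choice `sel`, the factors `|𝒴_{ℂ_p^♭,L′_w}|` of «`𝒴_{L′} = ∏_{w∈V_{L′}} |𝒴_{ℂ_p^♭,L′_w}|`» [ATS II½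
Def. 4.1.1] (p.139 l.30–41), and «the natural (continuous) mapping [Fargues–Fontaine 2018, Prop. 2.3.20] `f_{w|v} : |𝒴_{ℂ_p^♭,L′_w}| →
|𝒴_{ℂ_p^♭,L_mod,v}|`» (p.140 l.3–20) = `proj`) — Thm. 10.11.3.1 (1) IS Thm. 6.1.1 (same sentence, same proof), so its construction is E-t10's
`ModuliDescentDatum.descend`, imported, not re-typed. Added here: holomorphoids `hol(X/L′)_y` with their arithmeticoid `y ∈ 𝒴_{L′}` and their
local holomorphoids «`(X/L′_v, X/K_v) = hol(X/L′_v)_{y_v}`» (§10.11.4); the objects of the local spaces `J(X, L′_v)` of «the adelic Arithmetic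
Teichmuller Space `J̃(X/L)` … a product of local arithmetic Teichmuller spaces» (§10.11.2, [ATS I] Thm. 9.3.1) with «by [Joshi, 2023a,
Proposition 6.1.2] … an arithmeticoid `arith(L)_y` associated to `((X/L_v, X/K_v))_{v∈V_L} ∈ J̃(X/L)`» (§10.11.3); the tempered Frobenioid of
a local holomorphoid «associated to it by § 10.9, [Joshi, 2023a, Definition 5.14.1]» (§10.11.4) valued in a TYPE PARAMETER `FT` of tempered-Frobenioid
data with its isomorphism notion — to be instantiated with seat E-t34's `ATS3.TemperedCoverings` (`Joshi/TemperedFrobenioidsJoshi.lean`, §10.7–§10.9;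
kept a parameter so that this signature does not depend on that file); and the Frobenioids «`Frob(arith(L_mod)_y)` (resp. `Frob(arith(L_mod)_y)^ℝ`) … associated to the arithmeticoid by
[Joshi, 2023a, Proposition 6.1.2]», «`Frob(L_mod)^ℝ` the realification of the Frobenioid of the number field `L_mod` (see § 10.5)» and the
perfection `Frob(L_mod)^pf` (Thm. 10.11.3.1 (3)) as seat E-t34's `ATS3.ElementaryFrobenioid`s (§3 below CONSTRUCTS the first two from
residue-field values). `L_mod` itself («the field generated over `ℚ` by the `j`-invariant», p.138 l.51–53) is the tree's
`Literature.IUT.HodgeTheaters.fieldOfModuli` (BY NAME). INTERIM CARRIERS (merge-debt): `Hol`/`pt` = seat T-05's holomorphoids; `ATS` = seat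
E-t1's `Summit.ABC.IUTFork.Joshi.ATSObj` assembled adelically (seat E-t25). [claim: Joshi2024ATS3, status: disputed] -/
structure HodgeTheaterDatum (M : ModuliDescentDatum) (FT : Type 1) : Type 1 where
  /-- holomorphoids `hol(X/L′)_y` -/
  Hol : Type
  /-- the arithmeticoid `y ∈ 𝒴_{L′}` of a holomorphoid -/
  pt : Hol → M.Arith
  /-- objects of the local arithmetic Teichmüller space `J(X, L′_v)` -/
  ATS : M.VL' → Type
  /-- the local holomorphoids `(X/L′_v, X/K_v) = hol(X/L′_v)_{y_v}` of a holomorphoid ([J-III] Lem. 2.1.6) -/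
  localOf : Hol → ∀ v, ATS v
  /-- the arithmeticoid of a point of `J̃(X/L)` ([ATS II½] Prop. 6.1.2, §10.11.3) -/
  arithOfPoint : (∀ v, ATS v) → M.Arith
  /-- the tempered Frobenioid `Frob^temp((X/L′_v, X/K_v))` of a local holomorphoid (§10.9, [ATS II½] Def. 5.14.1) -/
  frobTempAt : ∀ v, ATS v → FT
  /-- isomorphisms of tempered Frobenioids (the local isomorphisms Thm. 10.11.5.1 speaks of) -/
  IsoFT : FT → FT → Type
  /-- `Frob(arith(L_mod)_y)`, the (perfect) Frobenioid of an arithmeticoid of `L_mod` ([ATS II½] Prop. 6.1.2) -/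
  frobArith : M.ArithMod → ElementaryFrobenioid.{0}
  /-- `Frob(arith(L_mod)_y)^ℝ`, its realified Frobenioid -/
  frobArithR : M.ArithMod → ElementaryFrobenioid.{0}
  /-- `Frob(L_mod)^pf`, the perfection of the Frobenioid of the number field `L_mod` -/
  frobModPf : ElementaryFrobenioid.{0}
  /-- `Frob(L_mod)^ℝ`, its realification (§10.5) -/
  frobModR : ElementaryFrobenioid.{0}

namespace HodgeTheaterDatum

variable {M : ModuliDescentDatum} {FT : Type 1} (𝔇 : HodgeTheaterDatum M FT)

/-- **Thm. 10.11.3.1 (1)–(2)** (p.139 l.9–20): «(1) the bijection `V_{L_mod} ≃ V ⊂ V_{L′}` together with the arithmeticoid `y` provides us with an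
arithmeticoid `arith(L_mod)_{y̲}` … (2) every holomorphoid `hol(X/L′)_y` of `X/L′` provides us an arithmeticoid `arith(L_mod)_{y̲}` of `L_mod`»; proof =
the CONSTRUCTION p.139 l.28 – p.140 l.25 «define `y̲ = (f_{w|v}(y′_w))_{w∈V}`» — the same sentence and construction as [J-III] Thm. 6.1.1, hence (1) IS
seat E-t10's `ModuliDescentDatum.descend` (not re-typed) and (2) is its composite with the holomorphoid's point. This is the STANDARD ARITHMETICOID
`arith(L_mod)_y` cited in the statement of Prop. 9.7.5.1 (p.112 l.42–43) and at p.100 l.17, p.106 l.28. [claim: Joshi2024ATS3, status: disputed] -/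
def moduliOfHol (h : 𝔇.Hol) : M.ArithMod := M.descend (𝔇.pt h)

/-- §10.11.3 + Thm. 10.11.3.1 (1) for a POINT of the adelic space `J̃(X/L)` (p.139 l.5–17): its arithmeticoid of `L_mod`, through [ATS II½]
Prop. 6.1.2 (`arithOfPoint`, data) and the descent. [claim: Joshi2024ATS3, status: disputed] -/
def moduliOfPoint (P : ∀ v, 𝔇.ATS v) : M.ArithMod := M.descend (𝔇.arithOfPoint P)

/-- **Thm. 10.11.3.1 (3)** (p.139 l.21–27): «and hence by [Joshi, 2023a, Proposition 6.1.2] a (perfect) frobenioid `Frob(arith(L_mod)_{y̲})`, and a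
realified Frobenioid `Frob(arith(L_mod)_{y̲})^ℝ` which are isomorphic (by [Joshi, 2023a, Proposition 6.1.2]) to the perfection `Frob(L_mod)^pf`
and the realification `Frob(L_mod)^ℝ` of the Frobenioid of the number field `L_mod` respectively.» HYPOTHESIS (an [ATS II½] claim, Prop.
5.15.1 / §5.16, seat T-37's paper), never asserted; the word «(perfect)» is DERIVED in §3 (`ArithmeticoidAbsDatum.isPerfectDiv_frobArith`).
[claim: Joshi2024ATS3, status: disputed] -/
@[claim "Joshi2024ATS3" "disputed"]
def ArithFrobenioidsOfModuli : Prop :=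
  ∀ y : M.Arith, (𝔇.frobArith (M.descend y)).IsIso 𝔇.frobModPf ∧ (𝔇.frobArithR (M.descend y)).IsIso 𝔇.frobModR

/-- **A Hodge theater à la Joshi** — the SHAPE of (10.11.4.1)/(10.11.4.2) (p.140 l.38–63): «a Hodge Theater, in the sense of [Mochizuki, 2021a,
Definition 3.6]»: a family of tempered Frobenioids indexed by `v ∈ V_{L′}` and a global (realified) Frobenioid: «`HT((X/L′_v, X/K_v)_v)_y =
({Frob^temp((X/L′_v, X/K_v))}_v, Frob(arith(L_mod)_{y̲})^ℝ)`» (10.11.4.1), «in the style of [Mochizuki, 2021a] …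
`({Frob^temp((X/L′_v,X/K_v))}_{v∈V_{L′}}, Frob(L_mod)^ℝ_y)`» (10.11.4.2). OUR SIDE (BY NAME): `Literature.IUT.HodgeTheaters.ThetaHodgeTheater`
([IUTchI] Def. 3.6 `({†F̲_v}_{v∈V̲}, †F⊩_mod)`); flag for E-ref: Joshi's local data are indexed by ALL `v ∈ V_{L′}`, [IUTchI]'s by `v̲ ∈ V̲ ≃ V_mod`.
Rmk. 10.11.5.2 (1): «Mochizuki defines other versions of Hodge Theaters `HT^?` with more refined conditions and decorations, but I will not recall
these here.» [claim: Joshi2024ATS3, status: disputed] -/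
structure HodgeTheater (_𝔇 : HodgeTheaterDatum M FT) : Type 1 where
  /-- the local tempered Frobenioids `{Frob^temp((X/L′_v, X/K_v))}_{v ∈ V_{L′}}` -/
  loc : M.VL' → FT
  /-- the global realified Frobenioid `Frob(arith(L_mod)_{y̲})^ℝ` -/
  glob : ElementaryFrobenioid.{0}

/-- **(10.11.4.1): the Hodge theater `HT(hol(X/L′)_y)` of a holomorphoid** («one can associate to `hol(X/L′)_y`, a Hodge Theater … as follows»,
p.140 l.38–53) — a DEFINITION over the signature; by construction it is «labeled by the arithmetic holomorphic structure [it] arise[s] from»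
(Rmk. 10.11.4.3, p.140 l.64–65). Cited in the STATEMENT of [J-III] Thm.-Def. 9.8.1.1 (1)(c) («the Hodge-Theaters (given by § 10.11, (10.11.4.1),
and especially Theorem 10.11.5.1)», p.114 l.14–16; seat E-t22's file). = the first clause of Thm. 10.11.5.1. [claim: Joshi2024ATS3, status: disputed] -/
def hodgeTheaterOf (h : 𝔇.Hol) : 𝔇.HodgeTheater where
  loc v := 𝔇.frobTempAt v (𝔇.localOf h v)
  glob := 𝔇.frobArithR (𝔇.moduliOfHol h)

variable {𝔇} in
/-- **An isomorphism of Hodge theaters à la Joshi** (Thm. 10.11.5.1 «isomorphic Hodge Theaters»; proof p.141 l.14–25: «a non-canonical isomorphism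
between such data provided by any two holomorphoids», place by place, and of the global Frobenioids). READING ([IUTchI] Rmk. 3.6.2 / our
`Literature.IUT.HodgeTheaters.ThetaHodgeTheater.Iso`: isomorphisms of all constituents). [claim: Joshi2024ATS3, status: disputed] -/
structure HodgeTheater.Iso (H₁ H₂ : 𝔇.HodgeTheater) : Type where
  /-- at each place -/
  locIso : ∀ v, 𝔇.IsoFT (H₁.loc v) (H₂.loc v)
  /-- on the global realified Frobenioids -/
  globIso : H₁.glob.Iso H₂.glob

/-- **Theorem 10.11.5.1** (p.141 l.1–3; «This is an important point for [Mochizuki, 2021c]», p.140 l.66): «Each holomorphoid `hol(X/L)_y`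
provides the Hodge-Theater `HT(hol(X/L′))_y` [the definition `hodgeTheaterOf`] and all these distinct holomorphoids give rise to isomorphic Hodge
Theaters.» HYPOTHESIS, never asserted. Rmk. 10.11.5.2 (2)–(5) (p.141 l.29–44), recorded verbatim as the interpretive context, NO adjudication
(E6 attach-point candidate; [Scholze 2021] is named by Joshi himself): «(2) Hodge Theaters of [Mochizuki, 2021a,b,c] consist of data coarser than
the geometric data of [Joshi, 2021a, 2022, 2023a]. … (3) The above proposition should be contrasted with [Scholze, 2021]. The central point which
is missing in [Mochizuki, 2021a,b,c] (and in [Scholze, 2021]) is the existence of geometrically inequivalent data providing the above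
Hodge-Theaters. (4) Readers of [Scholze, 2021] may have drawn the (erroneous) conclusion that the equivalence of Hodge-Theaters invalidates the
methodology and the claims of [Mochizuki, 2021a,b,c]. (5) So let me say this clearly: [Mochizuki, 2021c, Corollary 3.12] is not about
Hodge-Theaters or fundamental groups per se, but about averaging arithmetic and geometric data arising from distinct arithmetic holomorphic
structures. That distinct arithmetic holomorphic structures exist and that such an averaging is possible is asserted in [Mochizuki,
2021a,b,c] and unequivocally established in the present series of papers». [claim: Joshi2024ATS3, status: disputed] -/
@[claim "Joshi2024ATS3" "disputed"]
def HodgeTheatersIsomorphic : Prop := ∀ h₁ h₂ : 𝔇.Hol, Nonempty ((𝔇.hodgeTheaterOf h₁).Iso (𝔇.hodgeTheaterOf h₂))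

/-- The Hodge theater of a holomorphoid is «labeled by the arithmetic holomorphic structure it arises from» (Rmk. 10.11.4.3): its global component
IS the realified Frobenioid of the descended arithmeticoid `y̲` of Thm. 10.11.3.1 — definitional bookkeeping of the typing. [folklore] -/
theorem hodgeTheaterOf_glob (h : 𝔇.Hol) : (𝔇.hodgeTheaterOf h).glob = 𝔇.frobArithR (M.descend (𝔇.pt h)) := rfl

variable {𝔇} in
/-- A Hodge theater is isomorphic to itself (the trivial case of Thm. 10.11.5.1) as soon as the local isomorphism notion has identities. [folklore] -/
theorem hodgeTheater_iso_refl (idFT : ∀ T, 𝔇.IsoFT T T) (H : 𝔇.HodgeTheater) : Nonempty (H.Iso H) :=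
  ⟨⟨fun _ => idFT _, ElementaryFrobenioid.Iso.refl _⟩⟩

end HodgeTheaterDatum

/-! ## 2. The values behind the data: `Frob(arith(L)_y)` constructed from the residue fields (ATS II½ Def. 5.14.2, §5.16) -/

/-- `Φ^ℝ ⊆ ∏_v ℝ^×`: the families of values in `(0,1]` — the divisor monoid of a REALIFIED Frobenioid rendered by values [ATS II½ §5.16;
Prop. 10.4.1.1 (2)]. [claim: Joshi2024ATS3, status: disputed] -/
def realDivMonoid (Pl : Type) : Submonoid (Pl → ℝˣ) where
  carrier := {r | ∀ v, 0 < ((r v : ℝˣ) : ℝ) ∧ ((r v : ℝˣ) : ℝ) ≤ 1}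
  one_mem' _ := by simp
  mul_mem' {r s} hr hs v := by
    simp only [Pi.mul_apply, Units.val_mul]
    exact ⟨mul_pos (hr v).1 (hs v).1, mul_le_one₀ (hr v).2 (hs v).1.le (hs v).2⟩

/-- The residue-field VALUES of an arithmeticoid (the `AbsoluteValue`-valued twin of seat T-37's `ATS2h.DeformationDatum` fields `K`, `absK`,
`emb`; [ATS II½ Def. 5.1.1 «for each v one is given an untilt `(L_v ↪ K_v, K_v^♭ ≃ L̂_v^♭)`», Prop. 6.1.2]): over places `Pl`, point sets
`Pt v = |𝒴_{F_v,L_v}|` and residue fields `K v y = K_{y_v}` (parameters — no instance declared), the absolute values `|−|_{K_{y_v}}` [FF18]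
and the embeddings of `L`. [claim: Joshi2024ATS3, status: disputed] -/
structure ArithmeticoidAbsDatum (L : Type) [Field L] (Pl : Type) (Pt : Pl → Type) (K : ∀ v, Pt v → Type)
    [∀ v y, Field (K v y)] : Type where
  /-- `|−|_{K_{y_v}}` -/
  abs : ∀ v y, AbsoluteValue (K v y) ℝ
  /-- `L ⊂ L_v ↪ K_{y_v}` -/
  emb : ∀ v (y : Pt v), L →+* K v y

namespace ArithmeticoidAbsDatum

variable {L : Type} [Field L] {Pl : Type} {Pt : Pl → Type} {K : ∀ v, Pt v → Type} [∀ v y, Field (K v y)]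
  (A : ArithmeticoidAbsDatum L Pl Pt K)

/-- `|−|` of `L` at `v` read in the arithmeticoid `y ∈ ∏_v Pt v`: `x ↦ |ι_v(x)|_{K_{y_v}}` — an induced Frobenioid structure (10.3.2).
[claim: Joshi2024ATS3, status: disputed] -/
def absAt (y : ∀ v, Pt v) (v : Pl) : AbsoluteValue L ℝ := Frob.induced (A.abs v (y v)) (A.emb v (y v))

/-- `Frob(arith(L)_y) = (L^*, Φ(arith(L)) = ⊕_v O^▹_{K_v}/O^*_{K_v}, L^* → Φ(arith(L))^gp)`, «the natural homomorphism given in the `v` component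
by `x ↦ ι_{L_v}(x) mod O^*_{K_v}`» [ATS II½ Def. 5.14.2] (Rmk. 10.5.6; Thm. 10.11.3.1 (3)), as an `ElementaryFrobenioid` over seat E-t32's
value rendering (10.2.3): `Φ^gp = ∏_v |K_{y_v}^*|`, `Φ = ∏_v |O^▹_{K_{y_v}}|`, `B = L^*`. [claim: Joshi2024ATS3, status: disputed] -/
def frobArith (y : ∀ v, Pt v) : ElementaryFrobenioid.{0} where
  Φ := ∀ v : Pl, Frob.divMonoid (A.abs v (y v))
  Gp := ∀ v : Pl, Frob.divGroup (A.abs v (y v))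
  toGp := MonoidHom.pi fun v =>
    { toFun := fun r => ⟨(r v).1, Frob.divMonoid_le_divGroup _ (r v).2⟩, map_one' := rfl, map_mul' := fun _ _ => rfl }
  B := Lˣ
  div := MonoidHom.pi fun v => (Frob.prin (A.abs v (y v))).comp (Units.map (A.emb v (y v) : L →* K v (y v)))

/-- The `v`-component of the principal divisor of `x ∈ L^*` in `Frob(arith(L)_y)` is the value `|ι_v x|_{K_{y_v}}`. [folklore] -/
theorem val_frobArith_div (y : ∀ v, Pt v) (x : Lˣ) (v : Pl) : (((A.frobArith y).div x v : ℝˣ) : ℝ) = A.absAt y v (x : L) := rfl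

/-- The REALIFIED Frobenioid `Frob(arith(L)_y)^ℝ` [ATS II½ §5.16: «the value group of an algebraically closed perfectoid field is rank one …
so one can view `Frob(arith(L))` as equipped with a natural realification»]: the value groups enlarged to `ℝ^×` (all units of `ℝ`, a
harmless enlargement of `ℝ_{>0}` for a SIGNATURE), `Φ^ℝ = {r : ∀ v, |r_v| ≤ 1}`, same principal divisors. [claim: Joshi2024ATS3, status: disputed] -/
def frobArithR (y : ∀ v, Pt v) : ElementaryFrobenioid.{0} where
  Φ := realDivMonoid Pl
  Gp := Pl → ℝˣ
  toGp := (realDivMonoid Pl).subtype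
  B := Lˣ
  div := MonoidHom.pi fun v => Frob.absUnits (A.absAt y v)

/-- The `v`-component of the principal divisor of `x ∈ L^*` in `Frob(arith(L)_y)^ℝ` is again `|ι_v x|_{K_{y_v}}` (realification does not
change principal divisors). [folklore] -/
theorem val_frobArithR_div (y : ∀ v, Pt v) (x : Lˣ) (v : Pl) : (((A.frobArithR y).div x v : ℝˣ) : ℝ) = A.absAt y v (x : L) := rfl

/-- **Thm. 10.11.3.1 (3), the word «(perfect)», DERIVED** when the residue fields `K_{y_v}` are algebraically closed (untilts are — ATS I §3,
seat E-t1's `Untilt`): every local divisor group `|K_{y_v}^*|` of `Frob(arith(L)_y)` is perfect (`n`-th roots), by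
`Frob.isPerfectDiv_of_isAlgClosed`. The ISOMORPHISM with `Frob(L_mod)^pf` asserted there is [ATS II½ Prop. 5.15.1] (seat T-37) and stays
the claim `ModuliDescentDatum.ArithFrobenioidsOfModuli`. [folklore] -/
theorem isPerfectDiv_frobArith [∀ v y, IsAlgClosed (K v y)] (y : ∀ v, Pt v) (v : Pl) : Frob.IsPerfectDiv (A.abs v (y v)) :=
  Frob.isPerfectDiv_of_isAlgClosed _

end ArithmeticoidAbsDatum

end Summit.ABC.IUTFork.Joshi.ATS3
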